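import Mathlib.Analysis.SpecialFunctions.Gamma.Deligne
import Mathlib.NumberTheory.LSeries.Basic
import Mathlib.NumberTheory.NumberField.Discriminant.Defs
import Mathlib.NumberTheory.NumberField.DedekindZeta
import Mathlib.Analysis.Meromorphic.Basic
import Mathlib.Topology.Algebra.InfiniteSum.Basic
import Mathlib.NumberTheory.NumberField.Cyclotomic.Galois
import Mathlib.NumberTheory.DirichletCharacter.Basic
import Mathlib.Topology.Algebra.Module.ModuleTopology
import Mathlib.LinearAlgebra.Eigenspace.Basic
import Mathlib.LinearAlgebra.Charpoly.Basic
import Mathlib.Algebra.Polynomial.Reverse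
import Literature.NumberTheory.GaloisRepresentations.AbsGaloisGroup
import Literature.NumberTheory.GaloisRepresentations.IntegralGaloisAction
import Literature.NumberTheory.GaloisRepresentations.ContinuousRep
import Literature.NumberTheory.GaloisRepresentations.GaloisRep
import Literature.NumberTheory.GaloisRepresentations.ArtinConductor
import HarnessLib

-- D-0014 sorry-sweep (operator, 2026-08-13): sorried theorems -> named facts `def X : Prop`; partial proofs preserved in comments
-- provenance: harness21/H21/H21/Prelude/GalRep/ArtinLFunction.lean @ bc02014 (interim HEAD d8f2665); M5 mechanical rewrite
/-!
# Artin representations and Artin L-functions (trunk GalRep, item C11 = `G09:ArtinLFunction`;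
notions `artin_L_function`, `conductor`)

An *Artin representation* of a number field `K` is a continuous representation
`ρ : Γ_K → GL(V)` of the absolute Galois group on a finite-dimensional complex vector space `V`
(continuity forces finite image).  Its Artin L-function is the Euler product
`L(ρ, s) = ∏_v det(1 - ρ(Frob_v) N v^{-s} | V^{I_v})⁻¹` over the finite places `v` of `K`
(Artin 1923/1930), absolutely convergent for `re s > 1`; the completed L-function
`Λ(ρ, s) = A(ρ)^{s/2} γ(ρ, s) L(ρ, s)` with `A(ρ) = |d_K|^{dim V} N 𝔣(ρ)` and archimedean
`Γ`-factors determined by the eigenvalues of complex conjugations satisfies (Artin, via Brauer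
induction) `Λ(ρ, 1 - s) = W(ρ) Λ(ρ^∨, s)` with `|W(ρ)| = 1`.

## Main definitions

* `Literature.ArtinRep K V := Literature.GaloisRep K ℂ V`, `Literature.FramedArtinRep K n := Literature.FramedGaloisRep K ℂ n`,
  `FramedArtinRep.toArtinRep`.
* `ArtinRep.eulerPolynomial ρ 𝔓 σ = det(1 - T ρ(σ) | V^{I_𝔓})` for `σ` in the decomposition
  group of `𝔓`, and `ArtinRep.eulerFactorAt ρ v` (a chosen arithmetic Frobenius at a chosen
  `𝔓 ∣ v`; junk value `1`).
* `Literature.artinLFunction ρ s = ∏' v, (eulerFactorAt ρ v)(N v ^ {-s})⁻¹` (a `tprod`).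
* Archimedean data: `ArtinRep.signature ρ φ` (dimensions of the `±1`-eigenspaces of a complex
  conjugation attached to the real embedding `φ`), `ArtinRep.gammaFactor`,
  `ArtinRep.artinConductorNorm` (`A(ρ) = |d_K|^{dim V} N 𝔣(ρ)`, *not* `N 𝔣(ρ)` alone),
  `Literature.NumberTheory.GaloisRepresentations.completedArtinLFunction`.
* Continuation predicates `Literature.NumberTheory.GaloisRepresentations.LFunction.HasEntireContinuation` (with the chosen
  `HasEntireContinuation.continuation`),
  `Literature.NumberTheory.GaloisRepresentations.LFunction.HasMeromorphicContinuation` (reused by Hecke L-functions, item C12, and G16),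
  and `ArtinRep.SatisfiesFunctionalEquation ρ ρ'` (two-argument form; the dual is supplied by
  the caller, e.g. `FramedRep.dual` for framed `ρ`).
* Sanity statements: `artinLFunction_trivial_eq_dedekindZeta` (Mathlib
  `NumberField.dedekindZeta`) and, for `K = ℚ`, `n = 1`,
  `artinLFunction_eq_LSeries_dirichletCharacter` (Mathlib `DirichletCharacter`, `LSeries`,
  `IsCyclotomicExtension.Rat.galEquivZMod`).

## Mathlib search

Mathlib (this pin) has `Complex.Gammaℝ`, `Complex.Gammaℂ` (`Analysis/SpecialFunctions/Gamma/
Deligne.lean`), `NumberField.discr`, `NumberField.dedekindZeta` (as an `LSeries`), `Meromorphic`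
(`Analysis/Meromorphic/Basic.lean`), `LSeries`, `DirichletCharacter`, `Matrix.charpolyRev` /
`Matrix.reverse_charpoly`, `LinearMap.charpoly`, `Module.End.eigenspace`, `tprod`, but no Artin
representation, Artin L-function or Euler factor of a Galois representation (grep `Artin`,
`eulerFactor`, `LFunction` in `Mathlib/NumberTheory`: only Dirichlet/Hurwitz L-functions and
`EulerProduct` for Dirichlet series).  Nothing here duplicates a Mathlib declaration.

## Design choices

* **Topology-on-`V` rule (OUTLINE D1, review 1).**  All *definitions* work for an arbitrary
  `[TopologicalSpace V]`; every *theorem* about an abstract `V` whose truth uses continuity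
  (`finite_range`, `multipliable_artinLFunction`, and all analytic statements downstream)
  assumes `[IsModuleTopology ℂ V]` (with the indiscrete topology continuity is vacuous and `ρ`
  need not have finite image).  Purely algebraic identities (`eulerFactorAt_spec`,
  `signature_eq`, …) hold for any topology and omit it.  `Fin n → ℂ` carries the module
  topology (`IsModuleTopology.instPi`), so framed statements need no such hypothesis.
* **Base field.**  `ArtinRep K V`, `eulerPolynomial`, `eulerFactorAt` and `signature` only
  assume `[Field K]` (costs nothing); every *theorem* involving finite places
  (`eulerFactorAt_spec`, `natDegree_eulerFactorAt_of_isUnramifiedAt`) and everything from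
  `artinLFunction` on assumes `[NumberField K]`: over a general field (e.g. an algebraically
  closed one, whose residue rings are infinite) `IsArithFrobAt` is unsatisfiable and
  `eulerFactorAt` would silently take its junk value `1`.
* **Frobenius convention (OUTLINE §1).**  Euler factors use an **arithmetic** Frobenius
  (Mathlib `IsArithFrobAt`, `x ↦ x ^ {N v} mod 𝔓`; Artin's convention).  Replacing `σ` by the
  geometric Frobenius `σ⁻¹` replaces `L(ρ, s)` by `L(ρ^∨, s)`; for Artin representations the
  factor at `v` is otherwise independent of the choices of `𝔓 ∣ v` and of `σ`
  (`eulerFactorAt_spec`).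
* `eulerFactorAt` follows OUTLINE D7: `Classical.choose` over
  `∃ 𝔓 σ, 𝔓 ∈ v.primesAbove ∧ IsArithFrobAt (𝓞 K) σ 𝔓`, **junk value `1`** otherwise (the
  existential always holds for number fields, `HeightOneSpectrum.primesAbove_nonempty` and
  `exists_isArithFrobAt_of_mem_primesAbove`, the latter currently sorried upstream, whence the
  `dite`).  The restriction of `ρ σ` to `V^{I_𝔓}` needs `σ` to normalise `I_𝔓`; we prove that the
  decomposition group does (`ContinuousRep.apply_mem_fixedSubmodule_inertia`), so
  `eulerPolynomial` takes `σ` in the decomposition subgroup and contains no junk.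
* `artinLFunction` is a `tprod` over `HeightOneSpectrum (𝓞 K)`; it is the intended value only
  where the product is multipliable (`multipliable_artinLFunction`, `re s > 1`), junk (`1`)
  elsewhere — continuation is expressed by the `LFunction.Has…Continuation` predicates.
* `signature ρ φ` uses the complex conjugation supplied by `Literature.exists_isComplexConjugation φ`
  (a real proof, item C2), so no junk value is needed; independence of the choice is
  `signature_eq`.
* No `ArtinRep.dual` on an abstract `V` (`Module.Dual ℂ V` has no topology in Mathlib); the
  functional equation is the two-argument predicate `SatisfiesFunctionalEquation ρ ρ'`.
* Names vs. OUTLINE C11: `signature` (outline `signatureAt`), `multipliable_artinLFunction`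
  (outline `multipliable_artinL`), per the work item; `Ideal.inv_mul_mul_mem_inertia` is an
  unbundled restatement of Mathlib's `(P.inertia (MulAction.stabilizer M P)).Normal` phrased
  with the H21 abbrev `Ideal.decompositionSubgroup` (item C3).

## References

* E. Artin, *Über eine neue Art von L-Reihen*, Abh. Math. Sem. Hamburg 3 (1923); *Zur Theorie
  der L-Reihen mit allgemeinen Gruppencharakteren*, ibid. 8 (1930).
* J. Martinet, *Character theory and Artin L-functions*, in: Algebraic Number Fields (Durham
  1975), Academic Press 1977, §§1–4.
* J. Neukirch, *Algebraic Number Theory* (1999), Ch. VII §10 (Artin L-series), §12 (functional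
  equation, Thm (12.6)).
* J. Tate, *Number theoretic background*, Proc. Symp. Pure Math. 33 (Corvallis 1979), part 2,
  §3–4.
-/

noncomputable section

open scoped NumberField Pointwise
open Field IsDedekindDomain Module NumberField

namespace Literature.NumberTheory.GaloisRepresentations

universe u w w'

/-! ### Artin representations -/

section Carrier

variable (K : Type u) [Field K]

/-- An **Artin representation** of `K` on the complex topological vector space `V`: a continuous
representation `Γ_K → GL(V)` (`Literature.GaloisRep K ℂ V`, joint continuity).  Intended for
finite-dimensional `V` with its module topology (`[IsModuleTopology ℂ V]`), in which case the
image is finite (`ArtinRep.finite_range`).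
Ref: Artin (1930); Martinet, *Character theory and Artin L-functions* (1977), §1. [cite: ArtinHamburg1931] -/
abbrev ArtinRep (V : Type w) [AddCommGroup V] [Module ℂ V] [TopologicalSpace V] :=
  GaloisRep K ℂ V

/-- A **framed Artin representation** of rank `n`: a continuous homomorphism
`Γ_K →ₜ* GL (Fin n) ℂ` (`Literature.FramedGaloisRep K ℂ n`).
Ref: Martinet, *Character theory and Artin L-functions* (1977), §1. [folklore] -/
abbrev FramedArtinRep (n : ℕ) :=
  FramedGaloisRep K ℂ n

variable {K}

/-- The Artin representation on `Fin n → ℂ` (module topology, `IsModuleTopology.instPi`)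
underlying a framed Artin representation (`Literature.NumberTheory.GaloisRepresentations.FramedRep.toContinuousRep`).
Ref: Martinet, *Character theory and Artin L-functions* (1977), §1. [folklore] -/
abbrev FramedArtinRep.toArtinRep {n : ℕ} (ρ : FramedArtinRep K n) : ArtinRep K (Fin n → ℂ) :=
  FramedRep.toContinuousRep ρ

end Carrier

/-! ### Invariance of `V^{I_𝔓}` under the decomposition group -/

namespace ContinuousRep

variable {G : Type*} [Group G] [TopologicalSpace G] {A : Type*} [CommRing A] [TopologicalSpace A]
  {M : Type*} [AddCommGroup M] [Module A M] [TopologicalSpace M]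

/-- If `σ⁻¹ H σ ⊆ H` then `ρ σ` maps `M^H` into itself.
Ref: Serre, *Local Fields*, Ch. VI §2 (functoriality of `V^{G_i}`). [folklore] -/
theorem apply_mem_fixedSubmodule (ρ : ContinuousRep G A M) {H : Subgroup G} {σ : G}
    (hσ : ∀ h ∈ H, σ⁻¹ * h * σ ∈ H) {v : M} (hv : v ∈ ρ.fixedSubmodule H) :
    ρ σ v ∈ ρ.fixedSubmodule H := by
  rw [mem_fixedSubmodule_iff] at hv ⊢
  intro h hh
  have := hv _ (hσ h hh)
  rw [map_mul, map_mul, Module.End.mul_apply, Module.End.mul_apply] at this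
  have h' := congrArg (ρ σ) this
  rwa [← Module.End.mul_apply, ← map_mul, mul_inv_cancel, map_one, Module.End.one_apply] at h'

omit [TopologicalSpace G] in
/-- The decomposition group `D_𝔓 = 𝔓.decompositionSubgroup G` (item C3, defeq to
`MulAction.stabilizer G 𝔓`) normalises the inertia group `I_𝔓`: `σ⁻¹ τ σ ∈ I_𝔓` for `σ ∈ D_𝔓`,
`τ ∈ I_𝔓`.  This is an unbundled **restatement** of Mathlib's instance
`(P.inertia (MulAction.stabilizer M P)).Normal` (`RingTheory/Ideal/Pointwise.lean`), from which
it is derived; declared in Mathlib's `Ideal` namespace for use next to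
`Ideal.inertia_le_stabilizer`.
Ref: Neukirch, *Algebraic Number Theory*, Ch. I §9, (9.5)–(9.6). [folklore] -/
theorem _root_.Ideal.inv_mul_mul_mem_inertia {S : Type*} [CommRing S] [MulSemiringAction G S]
    {𝔓 : Ideal S} {σ τ : G} (hσ : σ ∈ 𝔓.decompositionSubgroup G) (hτ : τ ∈ 𝔓.inertia G) :
    σ⁻¹ * τ * σ ∈ 𝔓.inertia G := by
  have hτ' : (⟨τ, 𝔓.inertia_le_stabilizer hτ⟩ : 𝔓.decompositionSubgroup G) ∈
      𝔓.inertia (𝔓.decompositionSubgroup G) := Ideal.coe_mem_inertia.mp hτ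
  have h := (inferInstance : (𝔓.inertia (𝔓.decompositionSubgroup G)).Normal).conj_mem _ hτ'
    ⟨σ, hσ⟩⁻¹
  rw [inv_inv] at h
  exact Ideal.coe_mem_inertia.mpr h

/-- For `σ` in the decomposition group `𝔓.decompositionSubgroup G` of `𝔓`, `ρ σ` preserves
`M^{I_𝔓}`.
Ref: Neukirch, *Algebraic Number Theory*, Ch. VII §10 (definition of the Euler factor at a
ramified prime). [folklore] -/
theorem apply_mem_fixedSubmodule_inertia {S : Type*} [CommRing S] [MulSemiringAction G S]
    (ρ : ContinuousRep G A M) {𝔓 : Ideal S} {σ : G} (hσ : σ ∈ 𝔓.decompositionSubgroup G)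
    {v : M} (hv : v ∈ ρ.fixedSubmodule (𝔓.inertia G)) :
    ρ σ v ∈ ρ.fixedSubmodule (𝔓.inertia G) :=
  ρ.apply_mem_fixedSubmodule (fun _ hτ => Ideal.inv_mul_mul_mem_inertia hσ hτ) hv

/-- The restriction `ρ(σ)|_{M^{I_𝔓}}` of `ρ σ`, `σ ∈ D_𝔓 = 𝔓.decompositionSubgroup G`, to the
inertia invariants (`LinearMap.restrict`).
Ref: Neukirch, *Algebraic Number Theory*, Ch. VII §10. [folklore] -/
def restrictInertiaInvariants {S : Type*} [CommRing S] [MulSemiringAction G S]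
    (ρ : ContinuousRep G A M) (𝔓 : Ideal S) (σ : 𝔓.decompositionSubgroup G) :
    Module.End A (ρ.fixedSubmodule (𝔓.inertia G)) :=
  (ρ σ).restrict fun _ hv => ρ.apply_mem_fixedSubmodule_inertia σ.2 hv

/-- Unfolding lemma for `restrictInertiaInvariants`: the restriction acts as `ρ σ` on the
underlying vectors (Mathlib `LinearMap.restrict_coe_apply`).
Ref: Neukirch, *Algebraic Number Theory*, Ch. VII §10. [folklore] -/
@[simp] theorem restrictInertiaInvariants_apply {S : Type*} [CommRing S] [MulSemiringAction G S]
    (ρ : ContinuousRep G A M) (𝔓 : Ideal S) (σ : 𝔓.decompositionSubgroup G)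
    (v : ρ.fixedSubmodule (𝔓.inertia G)) :
    (ρ.restrictInertiaInvariants 𝔓 σ v : M) = ρ σ v :=
  rfl

end ContinuousRep

/-! ### Euler factors -/

namespace ArtinRep

section EulerFactor

variable {K : Type u} [Field K] {V : Type w} [AddCommGroup V] [Module ℂ V] [TopologicalSpace V]

/-- An Artin representation on a finite-dimensional `V` with its module topology has **finite
image** (`Γ_K` is profinite and `GL_n(ℂ)` has no small subgroups).
Ref: Martinet, *Character theory and Artin L-functions* (1977), §1; Serre, *Abelian ℓ-adic
representations* (1968), Ch. I §1.1, Remark. [cite: SerreAbelianLadic1968, Ch. I §1.1 Remark] [cite: MartinetDurham1977, §1] -/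
def finite_range : Prop :=
  ∀ [NumberField K] [FiniteDimensional ℂ V] [IsModuleTopology ℂ V] (ρ : ArtinRep K V),
    (Set.range (ρ : absoluteGaloisGroup K → V →ₗ[ℂ] V)).Finite

variable [FiniteDimensional ℂ V]

/-- The **Euler polynomial** `det(1 - T · ρ(σ) | V^{I_𝔓}) ∈ ℂ[T]` of `σ ∈ D_𝔓` acting on the
inertia invariants: the reverse (`Polynomial.reverse`, cf. Mathlib `Matrix.reverse_charpoly`)
of the characteristic polynomial of `ρ.restrictInertiaInvariants 𝔓 σ`.
Ref: Artin (1930), §1; Neukirch, *Algebraic Number Theory*, Ch. VII §10, Def. (10.1) ff. [cite: ArtinHamburg1931] -/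
def eulerPolynomial (ρ : ArtinRep K V) (𝔓 : Ideal (absIntegers (𝓞 K) K))
    (σ : 𝔓.decompositionSubgroup (absoluteGaloisGroup K)) : Polynomial ℂ :=
  (ρ.restrictInertiaInvariants 𝔓 σ).charpoly.reverse

open scoped Classical in
/-- The **Euler factor** `L_v(ρ, T) = det(1 - T · ρ(Frob_𝔓) | V^{I_𝔓})` of `ρ` at the finite
place `v`, for a chosen prime `𝔓 ∣ v` of `\bar ℤ_K` and a chosen **arithmetic** Frobenius
`σ` at `𝔓` (Mathlib `IsArithFrobAt (𝓞 K) σ 𝔓`; `σ ∈ D_𝔓` by `IsArithFrobAt.mem_stabilizer`);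
**junk value `1`** if no such pair exists (OUTLINE D7).  For a number field `K` the pair always
exists (`HeightOneSpectrum.primesAbove_nonempty`, `exists_isArithFrobAt_of_mem_primesAbove`);
for a general field `K` (e.g. `K` algebraically closed of characteristic `0`, where the residue
rings are infinite and `IsArithFrobAt` is unsatisfiable) the junk branch may occur, which is why
every theorem about `eulerFactorAt` at finite places assumes `[NumberField K]`.  Independence of
the choices: `eulerFactorAt_spec`.  Frobenius sign convention: OUTLINE §1 (arithmetic).
Ref: Artin (1930), §1; Neukirch, *Algebraic Number Theory*, Ch. VII §10; Martinet (1977), §2. [cite: ArtinHamburg1931] -/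
def eulerFactorAt (ρ : ArtinRep K V) (v : HeightOneSpectrum (𝓞 K)) : Polynomial ℂ :=
  if h : ∃ 𝔓σ : Ideal (absIntegers (𝓞 K) K) × absoluteGaloisGroup K,
      𝔓σ.1 ∈ v.primesAbove ∧ IsArithFrobAt (𝓞 K) 𝔓σ.2 𝔓σ.1 then
    ρ.eulerPolynomial h.choose.1
      ⟨h.choose.2, by
        haveI := h.choose_spec.1.1
        exact h.choose_spec.2.mem_stabilizer⟩
  else 1

/-- The Euler factor has constant term `1` (in both branches of the definition, so no
`[NumberField K]` hypothesis is needed).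
Ref: Neukirch, *Algebraic Number Theory*, Ch. VII §10. [folklore] -/
theorem eulerFactorAt_coeff_zero (ρ : ArtinRep K V) (v : HeightOneSpectrum (𝓞 K)) :
    (ρ.eulerFactorAt v).coeff 0 = 1 := by
  unfold eulerFactorAt
  split_ifs with h
  · rw [eulerPolynomial, Polynomial.coeff_zero_reverse, (LinearMap.charpoly_monic _).leadingCoeff]
  · simp

end EulerFactor

section EulerFactorNumberField

/-! From here on everything involving finite places assumes `[NumberField K]` (review 1: over a
general field the `dite` in `eulerFactorAt` may take its junk branch). -/

variable {K : Type u} [Field K] [NumberField K] {V : Type w} [AddCommGroup V] [Module ℂ V]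
  [TopologicalSpace V] [FiniteDimensional ℂ V]

/-- Specification of `eulerFactorAt` (independence of the choices): for *every* prime `𝔓 ∣ v`
and *every* arithmetic Frobenius `σ` at `𝔓`, `eulerFactorAt ρ v = det(1 - T ρ(σ) | V^{I_𝔓})`
(primes above `v` are conjugate, `exists_smul_eq_of_mem_primesAbove`; Frobenii form an
`I_𝔓`-coset, `isArithFrobAt_mul_iff_of_mem_inertia`; and `I_𝔓` acts trivially on `V^{I_𝔓}`).
A purely algebraic identity, valid for any topology on `V`.
Ref: Neukirch, *Algebraic Number Theory*, Ch. VII §10, before (10.2); Martinet (1977), §2. [cite: MartinetDurham1977, §2] -/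
def eulerFactorAt_spec : Prop :=
  ∀ (ρ : ArtinRep K V) {v : HeightOneSpectrum (𝓞 K)} {𝔓 : Ideal (absIntegers (𝓞 K) K)} (h𝔓 : 𝔓 ∈ v.primesAbove) {σ : absoluteGaloisGroup K} (hσ : IsArithFrobAt (𝓞 K) σ 𝔓),
    ρ.eulerFactorAt v =
      ρ.eulerPolynomial 𝔓 ⟨σ, by haveI := h𝔓.1; exact hσ.mem_stabilizer⟩

-- Binder repair (2026-08-16): the header instance deliberately shadows the section's, which a
-- `def` does not capture (it ranged too widely before); the overlapping-instances linter is moot.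
set_option linter.overlappingInstances false in
/-- At an unramified place the Euler factor has degree `dim V` (`V^{I_𝔓} = V` and the pair
`(𝔓, Frob_𝔓)` exists since `K` is a number field).
Ref: Neukirch, *Algebraic Number Theory*, Ch. VII §10. [cite: NeukirchANT1999, Ch. VII §10 (10.1)]
(Binder repair 2026-08-16: `[NumberField K]` is written in the header so that it is a parameter of
the elaborated constant; as a section instance unused by the body it was silently dropped, so the
fact ranged over cases the printed theorem excludes.) -/
def natDegree_eulerFactorAt_of_isUnramifiedAt [NumberField K] : Prop :=
  ∀ (ρ : ArtinRep K V) {v : HeightOneSpectrum (𝓞 K)} (h : GaloisRep.IsUnramifiedAt v ρ),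
    (ρ.eulerFactorAt v).natDegree = finrank ℂ V

end EulerFactorNumberField

end ArtinRep

/-! ### The Artin L-function -/

section LFunction

variable {K : Type u} [Field K] [NumberField K] {V : Type w} [AddCommGroup V] [Module ℂ V]
  [TopologicalSpace V] [FiniteDimensional ℂ V]

/-- The **Artin L-function** `L(ρ, s) = ∏_v L_v(ρ, N v^{-s})⁻¹`, as an unconditional product
(`tprod`) over the finite places `v : HeightOneSpectrum (𝓞 K)` of the inverted Euler factors
`(eulerFactorAt ρ v)(N v ^ {-s})⁻¹` (`N v = v.residueCard`).  This is the genuine value for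
`re s > 1` (`multipliable_artinLFunction`) and the junk value of `tprod` where the product does
not converge unconditionally; analytic continuation is expressed separately
(`LFunction.HasMeromorphicContinuation`).
Ref: Artin (1923), (1930); Neukirch, *Algebraic Number Theory*, Ch. VII §10, Def. (10.1). [cite: ArtinHamburg1924] -/
def artinLFunction (ρ : ArtinRep K V) (s : ℂ) : ℂ :=
  ∏' v : HeightOneSpectrum (𝓞 K), ((ρ.eulerFactorAt v).eval ((v.residueCard : ℂ) ^ (-s)))⁻¹

/-- The Euler product of an Artin representation converges (unconditionally, indeed absolutely)
for `re s > 1`: the eigenvalues of Frobenius are roots of unity.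
Ref: Neukirch, *Algebraic Number Theory*, Ch. VII §10, remark after (10.1); Martinet (1977), §2. [cite: MartinetDurham1977, §2] -/
def multipliable_artinLFunction : Prop :=
  ∀ [IsModuleTopology ℂ V] (ρ : ArtinRep K V) {s : ℂ} (hs : 1 < s.re),
    Multipliable fun v : HeightOneSpectrum (𝓞 K) =>
      ((ρ.eulerFactorAt v).eval ((v.residueCard : ℂ) ^ (-s)))⁻¹

end LFunction

/-! ### Archimedean factors, conductor, completed L-function -/

namespace ArtinRep

section Archimedean

variable {K : Type u} [Field K] {V : Type w} [AddCommGroup V] [Module ℂ V] [TopologicalSpace V]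

/-- The **signature** `(n⁺, n⁻)` of `ρ` at the real embedding `φ : K →+* ℝ`: the dimensions of
the `+1`- and `-1`-eigenspaces (`Module.End.eigenspace`) of `ρ c` for the complex conjugation
`c ∈ Γ_K` attached to `φ` supplied by `Literature.exists_isComplexConjugation φ` (all such `c` are
conjugate, `IsComplexConjugation.isConj`, so the pair does not depend on the choice:
`signature_eq`).
Ref: Martinet, *Character theory and Artin L-functions* (1977), §3 (archimedean Euler
factors); Neukirch, *Algebraic Number Theory*, Ch. VII §12, p. 537. [folklore] -/
def signature (ρ : ArtinRep K V) (φ : K →+* ℝ) : ℕ × ℕ :=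
  (finrank ℂ (Module.End.eigenspace (ρ (exists_isComplexConjugation φ).choose) 1),
    finrank ℂ (Module.End.eigenspace (ρ (exists_isComplexConjugation φ).choose) (-1)))

/-- The signature may be computed with *any* complex conjugation attached to `φ`.
Ref: Martinet, *Character theory and Artin L-functions* (1977), §3. [cite: MartinetDurham1977, §3] -/
def signature_eq : Prop :=
  ∀ (ρ : ArtinRep K V) {φ : K →+* ℝ} {c : absoluteGaloisGroup K} (hc : IsComplexConjugation φ c),
    ρ.signature φ = (finrank ℂ (Module.End.eigenspace (ρ c) 1),
      finrank ℂ (Module.End.eigenspace (ρ c) (-1)))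

/-- `n⁺ + n⁻ = dim V`: a complex conjugation acts as an involution, so `V` is the direct sum of
its `±1`-eigenspaces.  Ref: Martinet, *Character theory and Artin L-functions* (1977), §3. [cite: MartinetDurham1977, §3] -/
def signature_fst_add_snd : Prop :=
  ∀ [FiniteDimensional ℂ V] (ρ : ArtinRep K V) (φ : K →+* ℝ),
    (ρ.signature φ).1 + (ρ.signature φ).2 = finrank ℂ V

variable [NumberField K]

/-- The **archimedean `Γ`-factor** of `ρ`:
`γ(ρ, s) = ∏_{w real} Γ_ℝ(s)^{n⁺_w} Γ_ℝ(s+1)^{n⁻_w} · ∏_{w complex} Γ_ℂ(s)^{dim V}`, with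
Mathlib's `Complex.Gammaℝ s = π^{-s/2} Γ(s/2)`, `Complex.Gammaℂ s = 2 (2π)^{-s} Γ(s)` and the
signature `(n⁺_w, n⁻_w)` at the real embedding `w.embedding_of_isReal`.
Ref: Martinet, *Character theory and Artin L-functions* (1977), §3; Neukirch, *Algebraic Number
Theory*, Ch. VII §12, (12.5)–(12.6); Tate, *Number theoretic background* (1979), (3.6). [folklore] -/
def gammaFactor (ρ : ArtinRep K V) (s : ℂ) : ℂ :=
  open scoped Classical in
  ∏ w : InfinitePlace K,
    if hw : w.IsReal then
      Complex.Gammaℝ s ^ (ρ.signature (InfinitePlace.embedding_of_isReal hw)).1 *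
        Complex.Gammaℝ (s + 1) ^ (ρ.signature (InfinitePlace.embedding_of_isReal hw)).2
    else Complex.Gammaℂ s ^ finrank ℂ V

/-- The **constant of the functional equation** `A(ρ) = |d_K|^{dim V} · N_{K/ℚ} 𝔣(ρ) : ℕ`
entering the completed L-function `Λ(ρ, s) = A(ρ)^{s/2} γ(ρ, s) L(ρ, s)` (`NumberField.discr`,
`GaloisRep.artinConductorNat` of item C10).  Beware: this is **not** the norm `N 𝔣(ρ)` of the
Artin conductor alone (that is `GaloisRep.artinConductorNat ρ`), but its product with the
`dim V`-th power of the absolute discriminant (OUTLINE C11 `artinConductorNorm`).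
Ref: Martinet, *Character theory and Artin L-functions* (1977), §4; Neukirch, *Algebraic Number
Theory*, Ch. VII §12, before (12.6) ("`c(L/K, χ) = |d_K|^{χ(1)} N(𝔣(χ))`"). [folklore] -/
def artinConductorNorm (ρ : ArtinRep K V) : ℕ :=
  (NumberField.discr K).natAbs ^ finrank ℂ V * GaloisRep.artinConductorNat ρ

/-- `A(ρ) ≠ 0` as soon as the conductor ideal is nonzero (e.g. `ρ` unramified almost
everywhere).  Ref: Neukirch, *Algebraic Number Theory*, Ch. VII §12. [folklore] -/
theorem artinConductorNorm_ne_zero (ρ : ArtinRep K V) (h : GaloisRep.artinConductor ρ ≠ ⊥) :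
    ρ.artinConductorNorm ≠ 0 := by
  refine mul_ne_zero (pow_ne_zero _ (Int.natAbs_ne_zero.mpr (NumberField.discr_ne_zero K))) ?_
  rw [GaloisRep.artinConductorNat, ne_eq, Ideal.absNorm_eq_zero_iff]
  exact h

end Archimedean

end ArtinRep

section Completed

variable {K : Type u} [Field K] [NumberField K] {V : Type w} [AddCommGroup V] [Module ℂ V]
  [TopologicalSpace V] [FiniteDimensional ℂ V]

/-- The **completed Artin L-function** `Λ(ρ, s) = A(ρ)^{s/2} γ(ρ, s) L(ρ, s)` with
`A(ρ) = ρ.artinConductorNorm` (genuine value for `re s > 1`, cf. `artinLFunction`).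
Ref: Martinet, *Character theory and Artin L-functions* (1977), §4; Neukirch, *Algebraic Number
Theory*, Ch. VII §12, Thm (12.6). [folklore] -/
def completedArtinLFunction (ρ : ArtinRep K V) (s : ℂ) : ℂ :=
  (ρ.artinConductorNorm : ℂ) ^ (s / 2) * ρ.gammaFactor s * artinLFunction ρ s

end Completed

/-! ### Continuation predicates -/

namespace LFunction

/-- `f : ℂ → ℂ` (an L-function given by a convergent Euler product / Dirichlet series on
`re s > 1`, junk elsewhere) **has entire continuation**: some entire function agrees with `f` on
`re s > 1` (unique by the identity theorem).
Ref: Neukirch, *Algebraic Number Theory*, Ch. VII §§5, 10 (formulation of continuation). [folklore] -/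
def HasEntireContinuation (f : ℂ → ℂ) : Prop :=
  ∃ g : ℂ → ℂ, Differentiable ℂ g ∧ ∀ s : ℂ, 1 < s.re → g s = f s

/-- `f : ℂ → ℂ` **has meromorphic continuation** to `ℂ`: some function meromorphic on all of
`ℂ` (Mathlib `Meromorphic`) agrees with `f` on `re s > 1`.
Ref: Neukirch, *Algebraic Number Theory*, Ch. VII §§5, 10. [folklore] -/
def HasMeromorphicContinuation (f : ℂ → ℂ) : Prop :=
  ∃ g : ℂ → ℂ, Meromorphic g ∧ ∀ s : ℂ, 1 < s.re → g s = f s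

/-- Entire continuation implies meromorphic continuation
(`Differentiable.meromorphicAt`-type fact).  Ref: Neukirch, *Algebraic Number Theory*, VII §5. [folklore] -/
theorem HasEntireContinuation.hasMeromorphicContinuation {f : ℂ → ℂ}
    (h : HasEntireContinuation f) : HasMeromorphicContinuation f := by
  obtain ⟨g, hg, hgf⟩ := h
  exact ⟨g, fun x => (hg.analyticAt x).meromorphicAt, hgf⟩

/-- A chosen **entire continuation** of `f` (`Exists.choose`; unique by the identity theorem,
so the choice is immaterial).  OUTLINE C11 `entireContinuation`.
Ref: Neukirch, *Algebraic Number Theory*, Ch. VII §5. [folklore] -/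
def HasEntireContinuation.continuation {f : ℂ → ℂ} (h : HasEntireContinuation f) : ℂ → ℂ :=
  h.choose

/-- The chosen continuation is entire.  Ref: Neukirch, *Algebraic Number Theory*, Ch. VII §5. [folklore] -/
theorem HasEntireContinuation.differentiable_continuation {f : ℂ → ℂ}
    (h : HasEntireContinuation f) : Differentiable ℂ h.continuation :=
  h.choose_spec.1

/-- The chosen continuation agrees with `f` on `re s > 1`.
Ref: Neukirch, *Algebraic Number Theory*, Ch. VII §5. [folklore] -/
theorem HasEntireContinuation.continuation_eq {f : ℂ → ℂ} (h : HasEntireContinuation f)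
    {s : ℂ} (hs : 1 < s.re) : h.continuation s = f s :=
  h.choose_spec.2 s hs

end LFunction

/-! ### Functional equation predicate -/

namespace ArtinRep

variable {K : Type u} [Field K] [NumberField K] {V : Type w} [AddCommGroup V] [Module ℂ V]
  [TopologicalSpace V] [FiniteDimensional ℂ V] {V' : Type w'} [AddCommGroup V'] [Module ℂ V']
  [TopologicalSpace V'] [FiniteDimensional ℂ V']

/-- `ρ` and `ρ'` **satisfy the Artin functional equation** (with `ρ'` in the role of the
contragredient `ρ^∨`): there are meromorphic functions `Λ`, `Λ'` on `ℂ` continuing the completed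
L-functions of `ρ`, `ρ'` from `re s > 1`, and a root number `W` with `‖W‖ = 1`, such that
`Λ(1 - s) = W · Λ'(s)` for all `s`.  Two-argument form because `Module.Dual ℂ V` carries no
topology; for framed `ρ` take `ρ' := (FramedRep.dual ρ).toArtinRep` (lang.S29).
Caveat (OUTLINE D1): for a junk topology on `V` the conductor ideal may be `⊥`, whence
`artinConductorNorm ρ = 0`, `Λ ≡ 0` on `re s > 1` and the predicate holds trivially; every
consumer excludes this (framed `ρ`, or `[IsModuleTopology ℂ V]`).
Ref: Artin (1930); Martinet, *Character theory and Artin L-functions* (1977), §4, Thm 4.5;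
Neukirch, *Algebraic Number Theory*, Ch. VII §12, Thm (12.6). [cite: ArtinHamburg1931] -/
def SatisfiesFunctionalEquation (ρ : ArtinRep K V) (ρ' : ArtinRep K V') : Prop :=
  ∃ Λ Λ' : ℂ → ℂ, Meromorphic Λ ∧ Meromorphic Λ' ∧
    (∀ s : ℂ, 1 < s.re → Λ s = completedArtinLFunction ρ s ∧ Λ' s = completedArtinLFunction ρ' s) ∧
    ∃ W : ℂ, ‖W‖ = 1 ∧ ∀ s : ℂ, Λ (1 - s) = W * Λ' s

/-- The functional equation predicate yields meromorphic continuation of `Λ(ρ, s)`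
(projection of the first witness).
Ref: Neukirch, *Algebraic Number Theory*, Ch. VII §12, Thm (12.6) and Cor. (10.6). [folklore] -/
theorem SatisfiesFunctionalEquation.hasMeromorphicContinuation {ρ : ArtinRep K V}
    {ρ' : ArtinRep K V'} (h : ρ.SatisfiesFunctionalEquation ρ') :
    LFunction.HasMeromorphicContinuation (completedArtinLFunction ρ) := by
  obtain ⟨Λ, _, hΛ, _, hagree, _⟩ := h
  exact ⟨Λ, hΛ, fun s hs => (hagree s hs).1⟩

end ArtinRep

/-! ### Sanity statements -/

section Sanity

variable (K : Type u) [Field K] [NumberField K]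

/-- The Artin L-function of the trivial one-dimensional representation is the Dedekind zeta
function: `L(𝟙, s) = ζ_K(s)` for `re s > 1` (Mathlib `NumberField.dedekindZeta`, an `LSeries`;
Euler product for `ζ_K`).
Ref: Neukirch, *Algebraic Number Theory*, Ch. VII §10, (10.4)(i) and §5, (5.2). [cite: NeukirchANT1999, Ch. VII (10.4)(i)] -/
def artinLFunction_trivial_eq_dedekindZeta : Prop :=
  ∀ {s : ℂ} (hs : 1 < s.re),
    artinLFunction (ContinuousRep.trivial (absoluteGaloisGroup K) ℂ ℂ) s =
      NumberField.dedekindZeta K s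

variable {m : ℕ} [NeZero m] (L : Type*) [Field L] [NumberField L] [IsCyclotomicExtension {m} ℚ L]
  [Algebra L (AlgebraicClosure ℚ)] [IsScalarTower ℚ L (AlgebraicClosure ℚ)]

/-- The rank-one framed Artin representation `ρ` of `ℚ` **is induced by the Dirichlet character**
`χ` mod `m` through the cyclotomic field `L = ℚ(ζ_m) ⊆ \bar ℚ`: for every `σ ∈ Γ_ℚ`,
`ρ(σ) = χ(a_σ)` where `σ|_L (ζ_m) = ζ_m ^ {a_σ}` (Mathlib `IsCyclotomicExtension.Rat.galEquivZMod`,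
`AlgEquiv.restrictNormalHom`; `L/ℚ` is Galois by `IsCyclotomicExtension.isGalois`).  With the
arithmetic Frobenius convention `Frob_p ↦ p mod m`.
Ref: Neukirch, *Algebraic Number Theory*, Ch. VII §10, (10.4)(ii); Washington, *Introduction to
Cyclotomic Fields*, Ch. 3. [folklore] -/
def FramedArtinRep.IsInducedByDirichletCharacter (ρ : FramedArtinRep ℚ 1)
    (χ : DirichletCharacter ℂ m) : Prop :=
  haveI := IsCyclotomicExtension.isGalois {m} ℚ L
  ∀ σ : absoluteGaloisGroup ℚ,
    ((FramedRep.det ρ σ : ℂˣ) : ℂ) =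
      χ (IsCyclotomicExtension.Rat.galEquivZMod m L
        (AlgEquiv.restrictNormalHom L (absoluteGaloisGroup.toAlgEquiv ℚ σ)) : ZMod m)

/-- Sanity check for `K = ℚ`, `n = 1`: if `ρ : Γ_ℚ → ℂˣ` is induced by a **primitive** Dirichlet
character `χ` mod `m` through `ℚ(ζ_m)`, then `L(ρ, s) = L(χ, s) = ∑ χ(n) n^{-s}` for `re s > 1`
(Mathlib `LSeries`).  Primitivity is needed at the primes `p ∣ m` (there `V^{I_p} = 0` iff `χ`
is ramified at `p`).
Ref: Neukirch, *Algebraic Number Theory*, Ch. VII §10, (10.4)(ii); Artin (1923), §1. [cite: ArtinHamburg1924] -/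
def artinLFunction_eq_LSeries_dirichletCharacter : Prop :=
  ∀ (ρ : FramedArtinRep ℚ 1) {χ : DirichletCharacter ℂ m} (hχ : χ.IsPrimitive) (hρ : ρ.IsInducedByDirichletCharacter L χ) {s : ℂ} (hs : 1 < s.re),
    artinLFunction ρ.toArtinRep s = LSeries (fun n : ℕ => χ (n : ZMod m)) s

end Sanity

end Literature.NumberTheory.GaloisRepresentations
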